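import Summits.MatrixMultiplication.MatrixMultiplication.Theorems.FarEdgeDescentNearWorlds
import HarnessLib

/-!
# FarEdgeDescent — 3D-LAWFUL SPECTRAL WORLDS (I): the laws, and the polytope world `W_poly`

Route `FarEdgeDescent` (lens «structural dichotomy», cell `decomp-mm`):
`closes : FiniteSaturation → AnchoredLogConvexity → MatrixMultiplication` over the far-edge profile
`f(x) = ω(1,x,1)`, excess `e(x) = f(x) − (x+1)`, near edge `d(t) = f(t) − 2`, `α = dualExponentAlpha ℂ`.

## Why (gen 24)
The separating MODEL WORLDS of gens 17–23 (`FarEdgeDescentExpFloor/…/SmoothWorlds/NearWorlds`) are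
ONE-DIMENSIONAL profiles standing in for `f`.  But `f` is the restriction to the pencil `(1,x,1)` of the
THREE-variable functional `K = ω(·,·,·)`: `S₃`-symmetric, positively homogeneous, monotone, jointly convex
(`omegaRect_convex`), sandwiched `max(a+b,b+c,c+a) ≤ K ≤ a+b+c`, and tied ACROSS shapes by typed 2D laws — the
FOLD `d(2/(K+1)) ≤ (2/(K+1))·e(K)` (`FarEdgeDescentAlphaPrice.dualDefect_le_excess`) and the CUBE LINE
`(K+2)·ω ≤ 3·ω(1,K,1)` (`FarEdgeDescentCornerFold.sum_mul_omega_le_three_mul_omegaRect`).  A 1D world that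
ignores them may certify an independence no exponent functional realises (two gen-21 worlds do: see
`FarEdgeDescentSpectralAudit`).  So worlds are built here as GENUINE 3-VARIABLE FUNCTIONALS in closed form —
support functions `h_𝒦 = max_{P∈𝒦}⟨·,P⟩` of a "spectrum" `𝒦 = T ∪ (dark points)`, `T = conv S₃·(1,1,0)` (so
`h_T = Σ − min`, the information bound) — their 3D LAWS are proved (symmetry, homogeneity, subadditivity,
convex combinations, monotonicity, sandwich), they are checked against the THEOREMS we hold on `ω(a,b,c)`
(the 24-row VXXZ 2024 table `vxxz2024Table`, `ω(1,1/3,5/3) = 8/3`-compatibility, Coppersmith's tight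
shapes `ω(1,t,r) = 1+r`, `α_W > 0.3213`), and only then are the route's leaves read off the pencil.

## This file: `W_poly(a,b,c) = max(Σ − m, (7Σ − 3m)/8)` (`Σ = a+b+c`, `m = min`), spectrum `T ∪ S₃·(7/8,1/2,7/8)`
Its pencil IS gen 23's `nearPolygonWorld` on `[0,1]` (corner at `α_W = 1/2`, slope `1/2`, `ω_W = 9/4`),
continued LAWFULLY to the far edge `x+1+(3−x)₊/8`: first zero `β_W = 3`, TRANSVERSAL landing (slope `7/8`),
FOLD-EXACT (`d(x) = x·e(2/x−1)` on `(0,1]`) and FOLD-TIGHT (`α_W(β_W+1) = 2`, cf.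
`FarEdgeDescentFoldCoupling`).  Shapes: `FiniteSaturation` ✓, `TameProfile` ✓ (two affine pieces),
`AnchoredLogConvexity` ✗, `SmoothProfile` ✗ — the cell [N2 ∧ W2 ∧ fold-tight] of the gen-24 atom table.
Companions: `FarEdgeDescentSpectralSlack` (`FiniteSaturation` WITHOUT fold-tightness),
`FarEdgeDescentSpectralHyp` (`AnchoredLogConvexity ∧ PowerAmortisation ∧ SmoothProfile` with NO saturated
shape), `FarEdgeDescentSpectralAudit` (cube-line audit of gen 21, ERRATUM for gen 23's parabola, the ARC
template).  No new `Prop` definitions: every statement is a closed formula over `ℝ`, `vxxz2024Table`, Mathlib.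
-/

set_option linter.dupNamespace false

noncomputable section

namespace Summit.MatrixMultiplication.MatrixMultiplication.Theorems.FarEdgeDescentSpectralWorlds

open Literature.Computability.AlgebraicComplexity
open Summit.MatrixMultiplication.MatrixMultiplication.Theorems.FarEdgeDescentSmoothCut
  (not_differentiableAt_of_slope_gap)
open Summit.MatrixMultiplication.MatrixMultiplication.Theorems.FarEdgeDescentNearWorlds (nearPolygonWorld)
open Filter Topology Set

/-! ## §0 Three-term `min`/`max` bookkeeping and the Engel inequality -/

/-- `min(a,b,c) ≤ a`. -/
theorem min3_le₁ (a b c : ℝ) : min a (min b c) ≤ a := min_le_left _ _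
/-- `min(a,b,c) ≤ b`. -/
theorem min3_le₂ (a b c : ℝ) : min a (min b c) ≤ b := (min_le_right _ _).trans (min_le_left _ _)
/-- `min(a,b,c) ≤ c`. -/
theorem min3_le₃ (a b c : ℝ) : min a (min b c) ≤ c := (min_le_right _ _).trans (min_le_right _ _)
/-- `a ≤ max(a,b,c)`. -/
theorem le_max3₁ (a b c : ℝ) : a ≤ max a (max b c) := le_max_left _ _
/-- `b ≤ max(a,b,c)`. -/
theorem le_max3₂ (a b c : ℝ) : b ≤ max a (max b c) := (le_max_left _ _).trans (le_max_right _ _)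
/-- `c ≤ max(a,b,c)`. -/
theorem le_max3₃ (a b c : ℝ) : c ≤ max a (max b c) := (le_max_right _ _).trans (le_max_right _ _)

/-- `Σ − min = ` the information bound `max(a+b, b+c, c+a)` (Huang–Pan form). -/
theorem sum_sub_min3 (a b c : ℝ) : a + b + c - min a (min b c) = max (a + b) (max (b + c) (c + a)) := by
  apply le_antisymm
  · have h : a + b + c - max (a + b) (max (b + c) (c + a)) ≤ min a (min b c) :=
      le_min (by linarith [le_max3₂ (a + b) (b + c) (c + a)])
        (le_min (by linarith [le_max3₃ (a + b) (b + c) (c + a)])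
          (by linarith [le_max3₁ (a + b) (b + c) (c + a)]))
    linarith
  · exact max_le (by linarith [min3_le₃ a b c])
      (max_le (by linarith [min3_le₁ a b c]) (by linarith [min3_le₂ a b c]))

/-- `min` of three is superadditive. -/
theorem min3_superadd (a b c a' b' c' : ℝ) :
    min a (min b c) + min a' (min b' c') ≤ min (a + a') (min (b + b') (c + c')) :=
  le_min (add_le_add (min3_le₁ _ _ _) (min3_le₁ _ _ _))
    (le_min (add_le_add (min3_le₂ _ _ _) (min3_le₂ _ _ _)) (add_le_add (min3_le₃ _ _ _) (min3_le₃ _ _ _)))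

/-- `max` of three is subadditive. -/
theorem max3_subadd (a b c a' b' c' : ℝ) :
    max (a + a') (max (b + b') (c + c')) ≤ max a (max b c) + max a' (max b' c') :=
  max_le (add_le_add (le_max3₁ _ _ _) (le_max3₁ _ _ _))
    (max_le (add_le_add (le_max3₂ _ _ _) (le_max3₂ _ _ _)) (add_le_add (le_max3₃ _ _ _) (le_max3₃ _ _ _)))

/-- `min` of three commutes with a nonnegative scalar. -/
theorem min3_mul {ν : ℝ} (hν : 0 ≤ ν) (a b c : ℝ) :
    min (ν * a) (min (ν * b) (ν * c)) = ν * min a (min b c) := by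
  rw [← mul_min_of_nonneg b c hν, ← mul_min_of_nonneg a (min b c) hν]

/-- `max` of three commutes with a nonnegative scalar. -/
theorem max3_mul {ν : ℝ} (hν : 0 ≤ ν) (a b c : ℝ) :
    max (ν * a) (max (ν * b) (ν * c)) = ν * max a (max b c) := by
  rw [← mul_max_of_nonneg b c hν, ← mul_max_of_nonneg a (max b c) hν]

/-- `min(a,b,c)` is monotone in `a`. -/
theorem min3_mono₁ {a a' : ℝ} (h : a ≤ a') (b c : ℝ) : min a (min b c) ≤ min a' (min b c) :=
  min_le_min_right _ h

/-- `max(a,b,c)` is monotone in `a`. -/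
theorem max3_mono₁ {a a' : ℝ} (h : a ≤ a') (b c : ℝ) : max a (max b c) ≤ max a' (max b c) :=
  max_le_max_right _ h

/-- `max` of two subadditive functionals is subadditive (pointwise form). -/
theorem max_subadd_of_le {A B A₁ B₁ A₂ B₂ : ℝ} (hA : A ≤ A₁ + A₂) (hB : B ≤ B₁ + B₂) :
    max A B ≤ max A₁ B₁ + max A₂ B₂ :=
  max_le (hA.trans (add_le_add (le_max_left _ _) (le_max_left _ _)))
    (hB.trans (add_le_add (le_max_right _ _) (le_max_right _ _)))

/-- **Engel / Cauchy–Schwarz in Sedrakyan form**: `(x+y)²/(X+Y) ≤ x²/X + y²/Y` for `X, Y > 0`. -/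
theorem engel {x y X Y : ℝ} (hX : 0 < X) (hY : 0 < Y) :
    (x + y) ^ 2 / (X + Y) ≤ x ^ 2 / X + y ^ 2 / Y := by
  rw [div_add_div _ _ hX.ne' hY.ne', div_le_div_iff₀ (by positivity) (by positivity)]
  nlinarith [sq_nonneg (x * Y - y * X), mul_pos hX hY]

/-! ## §1 The POLYTOPE world `W_poly` — dark orbit of `(7/8, 1/2, 7/8)`

`W_poly(a,b,c) := max( Σ − m , (7Σ − 3m)/8 )`, `Σ := a+b+c`, `m := min(a,b,c)`; i.e. the support function
of `conv(T ∪ S₃·(7/8,1/2,7/8))` where `T` is the hexagon of the trivial bound (`h_T = max(a+b,b+c,c+a) = Σ − m`)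
and `p·(a,b,c)` over the orbit of the dark point `p = (7/8,1/2,7/8)` maximises to `(7Σ − 3m)/8`. -/

section Poly

variable {W : ℝ → ℝ → ℝ → ℝ}
  (hW : ∀ a b c : ℝ, W a b c = max (a + b + c - min a (min b c)) ((7 * (a + b + c) - 3 * min a (min b c)) / 8))
include hW

/-- LAW: `S₃`-symmetry. -/
theorem poly_symm (a b c : ℝ) : W a b c = W b c a ∧ W a b c = W b a c := by
  refine ⟨?_, ?_⟩ <;> rw [hW, hW] <;> ac_rfl

/-- LAW: degree-one homogeneity (`ν ≥ 0`). -/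
theorem poly_hom {ν : ℝ} (hν : 0 ≤ ν) (a b c : ℝ) : W (ν * a) (ν * b) (ν * c) = ν * W a b c := by
  rw [hW, hW, min3_mul hν, mul_max_of_nonneg _ _ hν]
  congr 1 <;> ring

/-- LAW: subadditivity (Lotti–Romani shape), on all of `ℝ³`. -/
theorem poly_subadd (a b c a' b' c' : ℝ) :
    W (a + a') (b + b') (c + c') ≤ W a b c + W a' b' c' := by
  rw [hW, hW, hW]
  have h := min3_superadd a b c a' b' c'
  exact max_subadd_of_le (by linarith) (by linarith)

/-- LAW: joint convexity (convex-combination form, as `LottiRomani1983_convexComb_le`). -/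
theorem poly_convexComb {s t : ℝ} (hs : 0 ≤ s) (ht : 0 ≤ t) (a b c a' b' c' : ℝ) :
    W (s * a + t * a') (s * b + t * b') (s * c + t * c') ≤ s * W a b c + t * W a' b' c' := by
  rw [← poly_hom hW hs, ← poly_hom hW ht]
  exact poly_subadd hW _ _ _ _ _ _

/-- LAW: monotone in each slot (with `poly_symm`). -/
theorem poly_mono {a a' : ℝ} (h : a ≤ a') (b c : ℝ) : W a b c ≤ W a' b c := by
  rw [hW, hW]
  have h1 : min a' (min b c) ≤ min a (min b c) + (a' - a) := by
    rcases le_total a (min b c) with h0 | h0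
    · rw [min_eq_left h0]; linarith [min3_le₁ a' b c]
    · rw [min_eq_right h0]; linarith [min_le_right a' (min b c)]
  have h2 := min3_mono₁ h b c
  exact max_le_max (by linarith) (by linarith)

/-- LAW: the sandwich `max(a+b,b+c,c+a) ≤ W ≤ a+b+c` on `ℝ³₊` (information bound / trivial algorithm). -/
theorem poly_sandwich {a b c : ℝ} (ha : 0 ≤ a) (hb : 0 ≤ b) (hc : 0 ≤ c) :
    max (a + b) (max (b + c) (c + a)) ≤ W a b c ∧ W a b c ≤ a + b + c := by
  rw [hW, ← sum_sub_min3]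
  have hm : 0 ≤ min a (min b c) := le_min ha (le_min hb hc)
  exact ⟨le_max_left _ _, max_le (by linarith) (by linarith [min3_le₁ a b c])⟩

/-- PENCIL, near edge: for `x ≤ 1`, `W_poly(1,x,1) = 2 + (x − 1/2)₊/2` — LITERALLY the near template of
`FarEdgeDescentNearWorlds.nearPolygonWorld` (gen 23), which is hereby realised by a 3D-lawful world. -/
theorem poly_near {x : ℝ} (hx : x ≤ 1) : W 1 x 1 = (fun x : ℝ => 2 + max (x - 1 / 2) 0 / 2) x := by
  rw [hW]
  have hm : min (1 : ℝ) (min x 1) = x := by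
    rw [min_eq_left hx, min_eq_right hx]
  rw [hm]
  simp only
  rcases le_total x (1 / 2) with h | h
  · rw [max_eq_right (by linarith : x - 1 / 2 ≤ 0), max_eq_left (by linarith)]
    ring
  · rw [max_eq_left (by linarith : 0 ≤ x - 1 / 2), max_eq_right (by linarith)]
    ring

/-- PENCIL, far edge: for `x ≥ 1`, `W_poly(1,x,1) = x + 1 + (3 − x)₊/8` — saturated exactly from `β_W = 3`
on, landing TRANSVERSALLY with slope `7/8`. -/
theorem poly_far {x : ℝ} (hx : 1 ≤ x) : W 1 x 1 = x + 1 + max (3 - x) 0 / 8 := by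
  rw [hW]
  have hm : min (1 : ℝ) (min x 1) = 1 := by
    rw [min_eq_right hx, min_self]
  rw [hm]
  rcases le_total x 3 with h | h
  · rw [max_eq_left (by linarith : 0 ≤ 3 - x), max_eq_right (by linarith)]
    ring
  · rw [max_eq_right (by linarith : 3 - x ≤ 0), max_eq_left (by linarith)]
    ring

/-- PENCIL, one formula on all of `ℝ`: `W_poly(1,x,1) = max(2, x+1, 7/4 + x/2, (7x+11)/8)`. -/
theorem poly_pencil (x : ℝ) :
    W 1 x 1 = max (max 2 (x + 1)) (max (7 / 4 + x / 2) ((7 * x + 11) / 8)) := by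
  rcases le_total x 1 with h | h
  · rw [poly_near hW h]
    simp only
    rw [max_eq_left (by linarith : x + 1 ≤ 2), max_eq_left (by linarith : (7 * x + 11) / 8 ≤ 7 / 4 + x / 2)]
    rcases le_total x (1 / 2) with h2 | h2
    · rw [max_eq_right (by linarith : x - 1 / 2 ≤ 0), max_eq_left (by linarith : 7 / 4 + x / 2 ≤ 2)]
      ring
    · rw [max_eq_left (by linarith : 0 ≤ x - 1 / 2), max_eq_right (by linarith : 2 ≤ 7 / 4 + x / 2)]
      ring
  · rw [poly_far hW h, max_eq_right (by linarith : 2 ≤ x + 1),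
      max_eq_right (by linarith : 7 / 4 + x / 2 ≤ (7 * x + 11) / 8)]
    rcases le_total x 3 with h3 | h3
    · rw [max_eq_left (by linarith : 0 ≤ 3 - x), max_eq_right (by linarith : x + 1 ≤ (7 * x + 11) / 8)]
      ring
    · rw [max_eq_right (by linarith : 3 - x ≤ 0), max_eq_left (by linarith : (7 * x + 11) / 8 ≤ x + 1)]
      ring

/-- `α_W = 1/2`, `ω_W = 9/4`, `β_W = 3`: the three pencil landmarks. -/
theorem poly_landmarks :
    W 1 (1 / 2) 1 = 2 ∧ (∀ x : ℝ, 1 / 2 < x → 2 < W 1 x 1) ∧ W 1 1 1 = 9 / 4 ∧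
      W 1 3 1 = 3 + 1 ∧ (∀ x : ℝ, 1 ≤ x → x < 3 → x + 1 < W 1 x 1) := by
  refine ⟨?_, fun x hx => ?_, ?_, ?_, fun x hx1 hx3 => ?_⟩
  · rw [poly_near hW (by norm_num)]; norm_num
  · rcases le_or_gt x 1 with h | h
    · rw [poly_near hW h]
      simp only
      rw [max_eq_left (by linarith)]
      linarith
    · rw [poly_far hW h.le]
      have := le_max_right (3 - x) 0
      linarith
  · rw [poly_far hW le_rfl]; norm_num
  · rw [poly_far hW (by norm_num)]; norm_num
  · rw [poly_far hW hx1, max_eq_left (by linarith)]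
    linarith

/-- NEAR ATOM N2 (corner of slope `1/2` at `α_W = 1/2`, a GLOBAL support line) and FAR ATOM W2 (transversal
landing at `β_W = 3`, slope `7/8 < 1`, saturated beyond) — in the exact shapes of
`FarEdgeDescentNearVertex.not_mm_iff_corner_or_tangential` / `FarEdgeDescentContactTrichotomy`. -/
theorem poly_corner_and_transversal :
    (∀ x : ℝ, 2 + 1 / 2 * (x - 1 / 2) ≤ W 1 x 1) ∧
    (∀ y : ℝ, 3 ≤ y → W 1 y 1 = y + 1) ∧
    (∀ x : ℝ, 1 ≤ x → x ≤ 3 → W 1 3 1 - 7 / 8 * (3 - x) ≤ W 1 x 1) := by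
  refine ⟨fun x => ?_, fun y hy => ?_, fun x hx1 hx3 => ?_⟩
  · rcases le_or_gt x 1 with h | h
    · rw [poly_near hW h]
      have := le_max_left (x - 1 / 2) 0
      simp only
      linarith
    · rw [poly_far hW h.le]
      have h1 := le_max_left (3 - x) 0
      have h2 := le_max_right (3 - x) 0
      rcases le_or_gt x 3 with h3 | h3
      · linarith
      · linarith
  · rw [poly_far hW (by linarith), max_eq_right (by linarith)]
    ring
  · rw [poly_far hW hx1, max_eq_left (show (0 : ℝ) ≤ 3 - x by linarith),
      poly_far hW (show (1 : ℝ) ≤ 3 by norm_num)]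
    norm_num
    linarith

/-- THE COUPLING IS TIGHT HERE: `W_poly` is FOLD-TIGHT (`α_W(β_W+1) = (1/2)·4 = 2` and `β_W = 3` saturated)
and the fold is an EQUALITY along the whole pencil: `d(x) = x·e(2/x − 1)` for `0 < x ≤ 1` (the dark point
maximises both dual directions `(1,K,1)` and `(K,1,1) ~ (1, 2/(K+1)·…)`).  Near corner slope `s = 1/2`,
`α = 1/2`, far contact angle `1 − 7/8 = 1/8 = sα/2`: `FarEdgeDescentFoldCoupling.transversal_of_corner_at_fold`
with equality. -/
theorem poly_foldTight_foldExact :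
    ((1 / 2 : ℝ) * (3 + 1) = 2 ∧ W 1 3 1 = 3 + 1) ∧
    ∀ x : ℝ, 0 < x → x ≤ 1 → W 1 x 1 - 2 = x * (W 1 (2 / x - 1) 1 - 2 / x) := by
  refine ⟨⟨by norm_num, (poly_landmarks hW).2.2.2.1⟩, fun x hx0 hx1 => ?_⟩
  have hk : 1 ≤ 2 / x - 1 := by
    rw [le_sub_iff_add_le, le_div_iff₀ hx0]; linarith
  rw [poly_near hW hx1, poly_far hW hk]
  simp only
  rcases le_total x (1 / 2) with h | h
  · have h3 : 3 - (2 / x - 1) ≤ 0 := by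
      rw [sub_nonpos, le_sub_iff_add_le, le_div_iff₀ hx0]; linarith
    rw [max_eq_right (by linarith : x - 1 / 2 ≤ 0), max_eq_right h3]
    field_simp
    ring
  · have h3 : 0 ≤ 3 - (2 / x - 1) := by
      rw [sub_nonneg, sub_le_iff_le_add, div_le_iff₀ hx0]; linarith
    rw [max_eq_left (by linarith : 0 ≤ x - 1 / 2), max_eq_left h3]
    field_simp
    ring

/-- SHAPES of the route statements in `W_poly`: `FiniteSaturation`-shape HOLDS (`k = 3`), `TameProfile`-shape
holds (two affine pieces on `[1,∞)`), `AnchoredLogConvexity`-shape FAILS (at `m = 2`: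
`e(2)² = 1/64 > 0 = e(1)·e(3)`), `SmoothProfile`-shape FAILS (kink at `3`): the special leaf is NOT
load-bearing-free — `W_poly` is a 3D-lawful world of `FS ∧ ¬ALC ∧ ¬S`. -/
theorem poly_shapes :
    (∃ k : ℕ, 2 ≤ k ∧ W 1 k 1 = k + 1) ∧
    (∀ m : ℝ, 1 ≤ m → W 1 m 1 = max (m + 1) (7 / 8 * m + 11 / 8)) ∧
    ¬ (∀ m : ℝ, 1 < m → (W 1 m 1 - (m + 1)) ^ 2 ≤ (W 1 1 1 - 2) * (W 1 (2 * m - 1) 1 - 2 * m)) ∧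
    ¬ DifferentiableAt ℝ (fun y : ℝ => W 1 y 1) 3 := by
  refine ⟨⟨3, by norm_num, by exact_mod_cast (poly_landmarks hW).2.2.2.1⟩, fun m hm => ?_, fun h => ?_, ?_⟩
  · rw [poly_far hW hm]
    rcases le_total m 3 with h3 | h3
    · rw [max_eq_left (by linarith : 0 ≤ 3 - m), max_eq_right (by linarith)]
      ring
    · rw [max_eq_right (by linarith : 3 - m ≤ 0), max_eq_left (by linarith)]
      ring
  · have h2 := h 2 (by norm_num)
    rw [poly_far hW (by norm_num), poly_far hW le_rfl, poly_far hW (by norm_num)] at h2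
    norm_num at h2
  · refine not_differentiableAt_of_slope_gap (a := 7 / 8) (a' := 1) (by norm_num) ?_ ?_
    · filter_upwards [Ioo_mem_nhdsLT (show (1 : ℝ) < 3 by norm_num)] with x hx
      rw [slope_def_field, poly_far hW hx.1.le, poly_far hW (by norm_num),
        max_eq_left (by linarith [hx.2] : 0 ≤ 3 - x)]
      have hx3 : x - 3 < 0 := by linarith [hx.2]
      rw [div_le_iff_of_neg hx3]
      norm_num
      nlinarith [hx.2]
    · filter_upwards [self_mem_nhdsWithin] with y hy
      rw [slope_def_field, poly_far hW (le_of_lt (lt_trans (by norm_num) (mem_Ioi.1 hy))),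
        poly_far hW (by norm_num), max_eq_right (by linarith [mem_Ioi.1 hy] : 3 - y ≤ 0)]
      have hy3 : 0 < y - 3 := by linarith [mem_Ioi.1 hy]
      rw [le_div_iff₀ hy3]
      norm_num
      linarith

/-- NEAR SHAPES transfer from gen 23 verbatim: on the neighbourhood `(-∞,1)` of the near edge `W_poly(1,·,1)` IS
the polygon template, so it is NOT differentiable at `α_W = 1/2` (corner) — `NearSmooth`-shape fails,
`NearTame`-shape holds (`nearPolygonWorld`). -/
theorem poly_near_not_differentiableAt : ¬ DifferentiableAt ℝ (fun y : ℝ => W 1 y 1) (1 / 2) := by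
  have hev : (fun y : ℝ => W 1 y 1) =ᶠ[𝓝 (1 / 2 : ℝ)] fun x : ℝ => 2 + max (x - 1 / 2) 0 / 2 := by
    filter_upwards [Iio_mem_nhds (show (1 / 2 : ℝ) < 1 by norm_num)] with y hy
    exact poly_near hW (le_of_lt hy)
  rw [hev.differentiableAt_iff]
  exact nearPolygonWorld.2.2.1

/-- THEOREM-COMPATIBILITY: `W_poly` respects every row of the VXXZ 2024 table of rectangular upper bounds
(`vxxz2024Table`, 24 rows, incl. `ω ≤ 2.371552`, `α ≥ 0.321334`, `ω(1,2,1) ≤ 3.250385`), the exact value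
`ω(1, 1/3, 5/3) = 8/3` (tree `GradeOneThird`), and Coppersmith's `∀ t < 1 ∃ r, ω(1,t,r) = 1+r` with the uniform
length `r = 3`. -/
theorem poly_compat :
    (∀ κ b : ℝ, (κ, b) ∈ vxxz2024Table → W 1 κ 1 ≤ b) ∧
    W 1 (1 / 3) (5 / 3) = 8 / 3 ∧
    (∀ t : ℝ, 0 ≤ t → t ≤ 1 → ∀ r : ℝ, 3 ≤ r → W 1 t r = 1 + r) := by
  refine ⟨fun κ b h => ?_, ?_, fun t ht0 ht1 r hr => ?_⟩
  · simp only [vxxz2024Table, List.mem_cons, Prod.mk.injEq, List.not_mem_nil, or_false] at h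
    rcases h with ⟨rfl, rfl⟩ | ⟨rfl, rfl⟩ | ⟨rfl, rfl⟩ | ⟨rfl, rfl⟩ | ⟨rfl, rfl⟩ | ⟨rfl, rfl⟩ |
      ⟨rfl, rfl⟩ | ⟨rfl, rfl⟩ | ⟨rfl, rfl⟩ | ⟨rfl, rfl⟩ | ⟨rfl, rfl⟩ | ⟨rfl, rfl⟩ | ⟨rfl, rfl⟩ |
      ⟨rfl, rfl⟩ | ⟨rfl, rfl⟩ | ⟨rfl, rfl⟩ | ⟨rfl, rfl⟩ | ⟨rfl, rfl⟩ | ⟨rfl, rfl⟩ | ⟨rfl, rfl⟩ |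
      ⟨rfl, rfl⟩ | ⟨rfl, rfl⟩ | ⟨rfl, rfl⟩ | ⟨rfl, rfl⟩
    all_goals (rw [poly_pencil hW]; norm_num [max_def])
  · rw [hW]; norm_num [min_def, max_def]
  · rw [hW]
    have hm : min (1 : ℝ) (min t r) = t := by
      rw [min_eq_left (by linarith : t ≤ r), min_eq_right ht1]
    rw [hm, max_eq_left (by linarith)]
    linarith

end Poly

end Summit.MatrixMultiplication.MatrixMultiplication.Theorems.FarEdgeDescentSpectralWorlds
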